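import Literature.Barriers.Schanuel.LargeTranscendenceDegree
import Literature.NumberTheory.Transcendental.ExpSmallTrdeg
import HarnessLib

/-!
# Barrier (Schanuel) `LargeTranscendenceDegree`: Theorem 2.9 ⇔ Ch. 13 Theorem 3.1 (i), (iii), (iv)

`Literature/Barriers/Schanuel/LargeTranscendenceDegreeThm29Proofs.lean` — sibling proofs file of
`Literature/Barriers/Schanuel/LargeTranscendenceDegree.lean` for the named fact
`smallTrdeg_thm_2_9_pos` (Nesterenko–Philippon (eds.), LNM 1752, Ch. 14, Theorem 2.9). It is the
top of the decomposition of that fact: Theorem 2.9 is, clause by clause, items (i), (iii), (iv) of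
Ch. 13, Theorem 3.1 (M. Laurent), vendored as the named facts
`Literature.NumberTheory.Transcendental.Laurent2001_thm_3_1_i/iii/iv`
(`Literature/NumberTheory/Transcendental/ExpSmallTrdeg.lean`) — same data `x : Fin d → ℂ`,
`y : Fin ℓ → ℂ`, same fields `K = gridField`, `K₁ = gridField₁`, `K₂ = gridField₂`, same
numerology (`dℓ ≥ 2(ℓ + d)` ⟺ `2m + 2n ≤ mn`, `dℓ ≥ d + 2ℓ` ⟺ `m + 2n ≤ mn`, `dℓ > ℓ + d` ⟺
`m + n + 1 ≤ mn` with `m = d`, `n = ℓ`). No new definitions; proofs only.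

## What is proved here

* `smallTrdeg_thm_2_9_pos_iff` : `smallTrdeg_thm_2_9_pos ↔ (i) ∧ (iii) ∧ (iv)`, with the two
  directions `smallTrdeg_thm_2_9_pos_of_thm_3_1` and `smallTrdeg_thm_2_9_pos.thm_3_1_i/iii/iv`
  (and `.thm_3_1_ii` through `Laurent2001_thm_3_1_ii_iff_iii`).
* `smallTrdeg_thm_2_9_pos_of_cores` : the three θ-forms `ExpGridCore_i`, `ExpGridCore_iii`,
  `ExpGridCore_iv` (Baker 1975, Ch. 12 §5: "we assume that the field … has transcendence degree
  `1` and we derive a contradiction") imply `smallTrdeg_thm_2_9_pos`. Discharging those three is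
  what remains for `smallTrdeg_thm_2_9_pos_holds`.

## References

* [NesterenkoPhilippon2001] Yu. V. Nesterenko, P. Philippon (eds.), *Introduction to Algebraic
  Independence Theory*, LNM 1752 (2001), Ch. 13 Theorem 3.1 (PDF p. 233); Ch. 14 Theorem 2.9
  (PDF p. 249).
* [BakerTNT1975] A. Baker, *Transcendental Number Theory*, Cambridge Univ. Press (1975), Ch. 12
  §5, pp. 116–118.
-/

noncomputable section

open Complex IntermediateField
open Literature.NumberTheory.Transcendental

namespace Literature.Barriers.Schanuel

/-- **Theorem 2.9 from Theorem 3.1 (i), (iii), (iv)**: the three clauses of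
`smallTrdeg_thm_2_9_pos` are the three items, with `m = d`, `n = ℓ`. PROVED.
[cite: NesterenkoPhilippon2001, Ch. 14 Theorem 2.9; Ch. 13 Theorem 3.1] -/
theorem smallTrdeg_thm_2_9_pos_of_thm_3_1 (h₁ : Laurent2001_thm_3_1_i)
    (h₃ : Laurent2001_thm_3_1_iii) (h₄ : Laurent2001_thm_3_1_iv) : smallTrdeg_thm_2_9_pos := by
  intro d l x y hd hl hx hy
  refine ⟨fun h => h₁ d l x y hd hl hx hy (by omega), fun h => h₃ d l x y hd hl hx hy (by omega),
    fun h => h₄ d l x y hd hl hx hy (by omega)⟩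

/-- Theorem 2.9 gives item (i) (`t`-clause). PROVED.
[cite: NesterenkoPhilippon2001, Ch. 14 Theorem 2.9; Ch. 13 Theorem 3.1 (i)] -/
theorem smallTrdeg_thm_2_9_pos.thm_3_1_i (h : smallTrdeg_thm_2_9_pos) : Laurent2001_thm_3_1_i :=
  fun m n x y hm hn hx hy hmn => (h m n x y hm hn hx hy).1 (by omega)

/-- Theorem 2.9 gives item (iii) (`t₁`-clause). PROVED.
[cite: NesterenkoPhilippon2001, Ch. 14 Theorem 2.9; Ch. 13 Theorem 3.1 (iii)] -/
theorem smallTrdeg_thm_2_9_pos.thm_3_1_iii (h : smallTrdeg_thm_2_9_pos) :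
    Laurent2001_thm_3_1_iii :=
  fun m n x y hm hn hx hy hmn => (h m n x y hm hn hx hy).2.1 (by omega)

/-- Theorem 2.9 gives item (iv) (`t₂`-clause). PROVED.
[cite: NesterenkoPhilippon2001, Ch. 14 Theorem 2.9; Ch. 13 Theorem 3.1 (iv)] -/
theorem smallTrdeg_thm_2_9_pos.thm_3_1_iv (h : smallTrdeg_thm_2_9_pos) :
    Laurent2001_thm_3_1_iv :=
  fun m n x y hm hn hx hy hmn => (h m n x y hm hn hx hy).2.2 (by omega)

/-- Theorem 2.9 also gives item (ii), through the symmetry `(ii) ⇔ (iii)`. PROVED.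
[cite: NesterenkoPhilippon2001, Ch. 13 Theorem 3.1 (ii)] -/
theorem smallTrdeg_thm_2_9_pos.thm_3_1_ii (h : smallTrdeg_thm_2_9_pos) :
    Laurent2001_thm_3_1_ii :=
  Laurent2001_thm_3_1_ii_iff_iii.mpr h.thm_3_1_iii

/-- **Theorem 2.9 ⇔ Theorem 3.1 (i) ∧ (iii) ∧ (iv).** PROVED.
[cite: NesterenkoPhilippon2001, Ch. 14 Theorem 2.9; Ch. 13 Theorem 3.1] -/
theorem smallTrdeg_thm_2_9_pos_iff :
    smallTrdeg_thm_2_9_pos ↔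
      Laurent2001_thm_3_1_i ∧ Laurent2001_thm_3_1_iii ∧ Laurent2001_thm_3_1_iv :=
  ⟨fun h => ⟨h.thm_3_1_i, h.thm_3_1_iii, h.thm_3_1_iv⟩,
    fun h => smallTrdeg_thm_2_9_pos_of_thm_3_1 h.1 h.2.1 h.2.2⟩

/-- **The assembly target.** Theorem 2.9 follows from the three θ-forms `ExpGridCore_i`,
`ExpGridCore_iii`, `ExpGridCore_iv` of `ExpSmallTrdeg.lean` (Baker 1975, Ch. 12 §5: reduce to a
field of transcendence degree `1`, i.e. to numbers algebraic over `ℚ(θ)` with `θ` transcendental,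
and derive a contradiction); with those three discharged, `smallTrdeg_thm_2_9_pos_holds` is this
theorem. PROVED (the implication). [cite: BakerTNT1975, Ch. 12 §5 pp. 116–118] -/
theorem smallTrdeg_thm_2_9_pos_of_cores (h₁ : ExpGridCore_i) (h₃ : ExpGridCore_iii)
    (h₄ : ExpGridCore_iv) : smallTrdeg_thm_2_9_pos :=
  smallTrdeg_thm_2_9_pos_of_thm_3_1 (Laurent2001_thm_3_1_i_of_core h₁)
    (Laurent2001_thm_3_1_iii_of_core h₃) (Laurent2001_thm_3_1_iv_of_core h₄)

end Literature.Barriers.Schanuel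

end
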